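import Mathlib
import Summits.Schanuel.Schanuel.Theses.RigidCore
import Summits.Schanuel.Schanuel.Theorems.RigidCoreMinimalCounterexampleInAclHitSetIsolation
import Summits.Schanuel.Schanuel.Theorems.RigidCoreMinimalCounterexampleInAclHitSetConstants

/-!
# S8‴ PROVED: the hit pattern of a corank-one first failure is `∅`-definable in the ring `ℤ`
# (crux stmt-Schanuel-0969 `RigidCore.MinimalCounterexampleInAcl`, line kernel-arithmetic-selection)

`--supports stmt-Schanuel-0969`; this file proves the registered stub `stub_corankOne_hitSetRingDefinable` (S8‴), the last open
piece of the corank-one sector of item 14744 under ARITHMETIC ISOLATION: for a first failure `x` of Schanuel's conjecture of rank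
`m + 1 ≥ 3` in corank-one normal form (`e^{x_k} ∈ ℚ̄` for `k < m`), the HIT PATTERN

  `H_x = {κ ∈ ℤ^m : (x_k + 2πiκ_k)_{k<m} is the u-part of a mate of x}`

is `∅`-definable in `(ℤ, +, ·)` for every compatible ring-language structure on `ℤ` — i.e. `H_x` is an ARITHMETICAL set.

Assembly of the foundation files landed under this stub:

* PRESENTATION (`mem_hitSet_iff_box`, …HitSetIsolation): `κ ∈ H_x` iff some closed rational box `B` contains a zero of
  `F_κ(z) = Σ_{p∈S} |p(x'(κ,z), e^{x'(κ,z)})|²` (`S` a finite basis of the relation ideal of `(x, eˣ)`, `x'(κ,z) = (x_k + 2πiκ_k, z)_k`)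
  and, for every integer vector `N ≠ 0`, no zero of `G_{κ,N} = F_κ + |Σ Nᵢ x'(κ,z)ᵢ|²`;
* "`∃` zero in a box" is FIRST ORDER over `ℤ` for continuous non-negative functions whose values at Gaussian rationals form a
  ring-definable family (`ringDefinable_setOf_existsZeroInBox`, …HitSetZeroInBox: compactness + density);
* the values ARE ring-definable families: the coordinates of `(x'(κ, q), e^{x'(κ,q)})` at a Gaussian rational `q` are built from
  the integer parameters `κ`, the constants `x_k` (logarithms of algebraic numbers), `2πi`, `e^{x_k} ∈ ℚ̄`
  (…HitSetConstants: isolated zeros of `exp − α`), `q` and `e^q` (…HitSetExpEnclosure: Taylor sums by ring-definable primitive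
  recursion, …HitSetRecursion, and limits), combined by the rational-cut arithmetic of …HitSetBoxArith/…BoxArithComplex
  (sums, products, `|·|²`, evaluation of the fixed rational polynomials `p ∈ S`).

With the landed transfer `stub_arithmeticTransfer` (ring-definable ⟹ `∅`-definable in `ℂ_exp`) and the selector
`mem_expAcl_of_corankOne_definablePattern`, and S9 `stub_corankOne_noFullLine`, this closes the corank-one sector
(`corankOne_of_arithmeticIsolation` in the line skeleton).

References: status note `Cruxes/MinimalCounterexampleInAcl/Lines/kernel_arithmetic_selection.md` §Addendum c12; K. Weihrauch,
*Computable Analysis* (2000), §4.3, §6.3; H. Rogers (1967), §14–15 (arithmetical hierarchy).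
-/

noncomputable section

-- the summit namespace `Summit.Schanuel.Schanuel.…` repeats a component by design (D-0022)
set_option linter.dupNamespace false

open Set FirstOrder FirstOrder.Language Filter Topology

namespace Summit.Schanuel.Schanuel.Cruxes.MinimalCounterexampleInAcl.KernelArithmeticSelection

open Literature.ModelTheory.ExponentialFields Literature.NumberTheory.Transcendental

variable {m : ℕ}

/-! ## Continuity and zero sets of the presentation functions -/

/-- Evaluation of a fixed rational polynomial at continuously varying coordinates is continuous. -/
theorem continuous_mvPolynomial_aeval {ι : Type*} (p : MvPolynomial ι ℚ) {P : ℂ → ι → ℂ}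
    (hP : ∀ i, Continuous fun z => P z i) : Continuous fun z => MvPolynomial.aeval (P z) p := by
  induction p using MvPolynomial.induction_on with
  | C a => simp only [MvPolynomial.aeval_C]; exact continuous_const
  | add p q hp hq => simp only [map_add]; exact hp.add hq
  | mul_X p i hp => simp only [map_mul, MvPolynomial.aeval_X]; exact hp.mul (hP i)

/-- Kernel translation does not change the exponential. -/
theorem cexp_add_two_pi_I_int (u : ℂ) (k : ℤ) : Complex.exp (u + 2 * ↑Real.pi * Complex.I * (k : ℂ)) = Complex.exp u := by
  rw [Complex.exp_add, mul_comm (2 * ↑Real.pi * Complex.I) ((k : ℂ)), Complex.exp_int_mul_two_pi_mul_I, mul_one]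

/-- The coordinates of `(x'(κ, z), e^{x'(κ,z)})`, `x'(κ, z) = Fin.snoc (x_k + 2πiκ_k)_k z`, depend continuously on `z`. -/
theorem continuous_mateCoord (x : Fin (m + 1) → ℂ) (κ : Fin m → ℤ) (i : Fin (m + 1) ⊕ Fin (m + 1)) :
    Continuous fun z : ℂ => (Sum.elim (Fin.snoc (fun k => x (Fin.castSucc k) + 2 * ↑Real.pi * Complex.I * (κ k : ℂ)) z :
      Fin (m + 1) → ℂ) (Complex.exp ∘ (Fin.snoc (fun k => x (Fin.castSucc k) + 2 * ↑Real.pi * Complex.I * (κ k : ℂ)) z :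
      Fin (m + 1) → ℂ)) : Fin (m + 1) ⊕ Fin (m + 1) → ℂ) i := by
  rcases i with j | j
  · refine Fin.lastCases ?_ (fun k => ?_) j
    · simp only [Sum.elim_inl, Fin.snoc_last]; exact continuous_id'
    · simp only [Sum.elim_inl, Fin.snoc_castSucc]; exact continuous_const
  · refine Fin.lastCases ?_ (fun k => ?_) j
    · simp only [Sum.elim_inr, Function.comp_apply, Fin.snoc_last]; exact Complex.continuous_exp
    · simp only [Sum.elim_inr, Function.comp_apply, Fin.snoc_castSucc]; exact continuous_const

/-- Reassembling a tuple from its two blocks (under a quantifier block) does not change a condition. -/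
theorem setOf_sumElim_mem {α β M : Type*} (T : Set (α ⊕ β → M)) :
    {W : α ⊕ β → M | (Sum.elim (fun a => W (Sum.inl a)) (fun b => W (Sum.inr b)) : α ⊕ β → M) ∈ T} = T := by
  ext W
  simp only [mem_setOf_eq]
  rw [show (Sum.elim (fun a => W (Sum.inl a)) (fun b => W (Sum.inr b)) : α ⊕ β → M) = W from Sum.elim_comp_inl_inr W]

/-- Reassembling a tuple from its three blocks does not change a condition. -/
theorem setOf_sumElim₂_mem {α β γ M : Type*} (T : Set ((α ⊕ β) ⊕ γ → M)) :
    {W : (α ⊕ β) ⊕ γ → M | (Sum.elim (Sum.elim (fun a => W (Sum.inl (Sum.inl a))) (fun b => W (Sum.inl (Sum.inr b))))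
      (fun c => W (Sum.inr c)) : (α ⊕ β) ⊕ γ → M) ∈ T} = T := by
  ext W
  simp only [mem_setOf_eq]
  rw [show (Sum.elim (Sum.elim (fun a => W (Sum.inl (Sum.inl a))) (fun b => W (Sum.inl (Sum.inr b))))
    (fun c => W (Sum.inr c)) : (α ⊕ β) ⊕ γ → M) = W from by funext s; rcases s with ((a | b) | c) <;> rfl]

/-! ## The coordinate families at Gaussian-rational test points are ring-definable -/

section RingZ

variable [FirstOrder.Ring.CompatibleRing ℤ]

/-- Finite sums of squared norms of fixed rational polynomials at ring-definable coordinate families are ring-definable real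
families. [folklore] -/
theorem defR_sumNormSqAeval {σ ι : Type*} (S : Finset (MvPolynomial ι ℚ)) {P : (σ → ℤ) → ι → ℂ}
    (hP : ∀ i, ((∅ : Set ℤ).Definable Language.ring {w : _ ⊕ Fin 2 → ℤ | 0 < w (Sum.inr 1) ∧ ((w (Sum.inr 0) : ℤ) : ℝ) < ((w (Sum.inr 1) : ℤ) : ℝ) * ((Complex.re ∘ (fun v => P v i)) ∘ fun w' s => w' (Sum.inl s)) w} ∧ (∅ : Set ℤ).Definable Language.ring {w : _ ⊕ Fin 2 → ℤ | 0 < w (Sum.inr 1) ∧ ((w (Sum.inr 0) : ℤ) : ℝ) < ((w (Sum.inr 1) : ℤ) : ℝ) * ((Complex.im ∘ (fun v => P v i)) ∘ fun w' s => w' (Sum.inl s)) w})) :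
    (∅ : Set ℤ).Definable Language.ring {w : _ ⊕ Fin 2 → ℤ | 0 < w (Sum.inr 1) ∧ ((w (Sum.inr 0) : ℤ) : ℝ) < ((w (Sum.inr 1) : ℤ) : ℝ) * ((fun v => ∑ p ∈ S, Complex.normSq (MvPolynomial.aeval (P v) p)) ∘ fun w' s => w' (Sum.inl s)) w} :=
  defR_sum S fun p _ => defR_normSq (defC_congr (defC_mvPolynomial_aeval p hP) fun _ => rfl)

/-- **The coordinates of `(x'(κ, q), e^{x'(κ, q)})` at the Gaussian rational `q = (a + bi)/c` are ring-definable complex families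
of `(κ, a, b, c) ∈ ℤ^m × ℤ³`**, for `x` in corank-one normal form: `x_k` is a logarithm of the algebraic `e^{x_k}`, `2πi` and
`e^{x_k + 2πiκ_k} = e^{x_k}` are ring-definable constants (…HitSetConstants), `q` and `e^q` are ring-definable
(…BoxArithComplex, …ExpEnclosure). [folklore] -/
theorem defC_mateCoord (x : Fin (m + 1) → ℂ) (halg : ∀ i : Fin (m + 1), (i : ℕ) < m → IsAlgebraic ℚ (Complex.exp (x i)))
    (i : Fin (m + 1) ⊕ Fin (m + 1)) :
    ((∅ : Set ℤ).Definable Language.ring {w : _ ⊕ Fin 2 → ℤ | 0 < w (Sum.inr 1) ∧ ((w (Sum.inr 0) : ℤ) : ℝ) < ((w (Sum.inr 1) : ℤ) : ℝ) * ((Complex.re ∘ (fun w : Fin m ⊕ Fin 3 → ℤ => (Sum.elim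
      (Fin.snoc (fun k => x (Fin.castSucc k) + 2 * ↑Real.pi * Complex.I * ((w (Sum.inl k) : ℤ) : ℂ))
        ((((w (Sum.inr 0) : ℤ) : ℂ) + ((w (Sum.inr 1) : ℤ) : ℂ) * Complex.I) / ((w (Sum.inr 2) : ℤ) : ℂ)) : Fin (m + 1) → ℂ)
      (Complex.exp ∘ (Fin.snoc (fun k => x (Fin.castSucc k) + 2 * ↑Real.pi * Complex.I * ((w (Sum.inl k) : ℤ) : ℂ))
        ((((w (Sum.inr 0) : ℤ) : ℂ) + ((w (Sum.inr 1) : ℤ) : ℂ) * Complex.I) / ((w (Sum.inr 2) : ℤ) : ℂ)) : Fin (m + 1) → ℂ)) :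
      Fin (m + 1) ⊕ Fin (m + 1) → ℂ) i)) ∘ fun w' s => w' (Sum.inl s)) w} ∧ (∅ : Set ℤ).Definable Language.ring {w : _ ⊕ Fin 2 → ℤ | 0 < w (Sum.inr 1) ∧ ((w (Sum.inr 0) : ℤ) : ℝ) < ((w (Sum.inr 1) : ℤ) : ℝ) * ((Complex.im ∘ (fun w : Fin m ⊕ Fin 3 → ℤ => (Sum.elim
      (Fin.snoc (fun k => x (Fin.castSucc k) + 2 * ↑Real.pi * Complex.I * ((w (Sum.inl k) : ℤ) : ℂ))
        ((((w (Sum.inr 0) : ℤ) : ℂ) + ((w (Sum.inr 1) : ℤ) : ℂ) * Complex.I) / ((w (Sum.inr 2) : ℤ) : ℂ)) : Fin (m + 1) → ℂ)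
      (Complex.exp ∘ (Fin.snoc (fun k => x (Fin.castSucc k) + 2 * ↑Real.pi * Complex.I * ((w (Sum.inl k) : ℤ) : ℂ))
        ((((w (Sum.inr 0) : ℤ) : ℂ) + ((w (Sum.inr 1) : ℤ) : ℂ) * Complex.I) / ((w (Sum.inr 2) : ℤ) : ℂ)) : Fin (m + 1) → ℂ)) :
      Fin (m + 1) ⊕ Fin (m + 1) → ℂ) i)) ∘ fun w' s => w' (Sum.inl s)) w}) := by
  have hu : ∀ k : Fin m, ((∅ : Set ℤ).Definable Language.ring {w : _ ⊕ Fin 2 → ℤ | 0 < w (Sum.inr 1) ∧ ((w (Sum.inr 0) : ℤ) : ℝ) < ((w (Sum.inr 1) : ℤ) : ℝ) * ((Complex.re ∘ (fun w : Fin m ⊕ Fin 3 → ℤ =>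
      x (Fin.castSucc k) + 2 * ↑Real.pi * Complex.I * ((w (Sum.inl k) : ℤ) : ℂ))) ∘ fun w' s => w' (Sum.inl s)) w} ∧ (∅ : Set ℤ).Definable Language.ring {w : _ ⊕ Fin 2 → ℤ | 0 < w (Sum.inr 1) ∧ ((w (Sum.inr 0) : ℤ) : ℝ) < ((w (Sum.inr 1) : ℤ) : ℝ) * ((Complex.im ∘ (fun w : Fin m ⊕ Fin 3 → ℤ =>
      x (Fin.castSucc k) + 2 * ↑Real.pi * Complex.I * ((w (Sum.inl k) : ℤ) : ℂ))) ∘ fun w' s => w' (Sum.inl s)) w}) := fun k =>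
    defC_add (defC_const_of_isAlgebraic_cexp (halg (Fin.castSucc k) (by simp)))
      (defC_mul defC_const_twoPiI (defC_intCast (definableFun_proj_params _)))
  have ht : ((∅ : Set ℤ).Definable Language.ring {w : _ ⊕ Fin 2 → ℤ | 0 < w (Sum.inr 1) ∧ ((w (Sum.inr 0) : ℤ) : ℝ) < ((w (Sum.inr 1) : ℤ) : ℝ) * ((Complex.re ∘ (fun w : Fin m ⊕ Fin 3 → ℤ =>
      (((w (Sum.inr 0) : ℤ) : ℂ) + ((w (Sum.inr 1) : ℤ) : ℂ) * Complex.I) / ((w (Sum.inr 2) : ℤ) : ℂ))) ∘ fun w' s => w' (Sum.inl s)) w} ∧ (∅ : Set ℤ).Definable Language.ring {w : _ ⊕ Fin 2 → ℤ | 0 < w (Sum.inr 1) ∧ ((w (Sum.inr 0) : ℤ) : ℝ) < ((w (Sum.inr 1) : ℤ) : ℝ) * ((Complex.im ∘ (fun w : Fin m ⊕ Fin 3 → ℤ =>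
      (((w (Sum.inr 0) : ℤ) : ℂ) + ((w (Sum.inr 1) : ℤ) : ℂ) * Complex.I) / ((w (Sum.inr 2) : ℤ) : ℂ))) ∘ fun w' s => w' (Sum.inl s)) w}) :=
    defC_testPoint (definableFun_proj_params _) (definableFun_proj_params _) (definableFun_proj_params _)
  have he : ((∅ : Set ℤ).Definable Language.ring {w : _ ⊕ Fin 2 → ℤ | 0 < w (Sum.inr 1) ∧ ((w (Sum.inr 0) : ℤ) : ℝ) < ((w (Sum.inr 1) : ℤ) : ℝ) * ((Complex.re ∘ (fun w : Fin m ⊕ Fin 3 → ℤ =>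
      Complex.exp ((((w (Sum.inr 0) : ℤ) : ℂ) + ((w (Sum.inr 1) : ℤ) : ℂ) * Complex.I) / ((w (Sum.inr 2) : ℤ) : ℂ)))) ∘ fun w' s => w' (Sum.inl s)) w} ∧ (∅ : Set ℤ).Definable Language.ring {w : _ ⊕ Fin 2 → ℤ | 0 < w (Sum.inr 1) ∧ ((w (Sum.inr 0) : ℤ) : ℝ) < ((w (Sum.inr 1) : ℤ) : ℝ) * ((Complex.im ∘ (fun w : Fin m ⊕ Fin 3 → ℤ =>
      Complex.exp ((((w (Sum.inr 0) : ℤ) : ℂ) + ((w (Sum.inr 1) : ℤ) : ℂ) * Complex.I) / ((w (Sum.inr 2) : ℤ) : ℂ)))) ∘ fun w' s => w' (Sum.inl s)) w}) :=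
    defC_cexp_gaussRat (definableFun_proj_params _) (definableFun_proj_params _) (definableFun_proj_params _)
  rcases i with j | j
  · refine Fin.lastCases ?_ (fun k => ?_) j
    · exact defC_congr ht fun w => by simp
    · exact defC_congr (hu k) fun w => by simp
  · refine Fin.lastCases ?_ (fun k => ?_) j
    · exact defC_congr he fun w => by simp
    · exact defC_congr (defC_const_of_isAlgebraic (σ := Fin m ⊕ Fin 3) (halg (Fin.castSucc k) (by simp))) fun w => by
        simp only [Sum.elim_inr, Function.comp_apply, Fin.snoc_castSucc]
        rw [cexp_add_two_pi_I_int]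

end RingZ

/-! ## The registered stub -/

set_option linter.unusedVariables false in -- the registered signature names the instance binder `inst`
/-- **Stub S8‴ — THE HIT PATTERN OF A CORANK-ONE FIRST FAILURE IS RING-DEFINABLE OVER `ℤ` (PROVED).**  For a first failure `x` of
rank `m + 1 ≥ 3` with `e^{x_k}` algebraic for `k < m` (and pure in the last direction — unused), the set of `κ ∈ ℤ^m` such that
`(x_k + 2πiκ_k)_{k<m}` is the u-part of a mate of `x` is `∅`-definable in the ring `ℤ`, for every compatible ring-language
structure on `ℤ`: presentation by an isolating rational box (…HitSetIsolation) + zeros-in-boxes are first order over `ℤ`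
(…HitSetZeroInBox) + the coordinates of `(x'(κ, q), e^{x'(κ, q)})` at Gaussian rationals are arithmetical (…HitSetConstants,
…HitSetExpEnclosure, …HitSetBoxArith[Complex], …HitSetRecursion). [folklore] -/
theorem stub_corankOne_hitSetRingDefinable : ∀ (m : ℕ), 2 ≤ m → ∀ (x : Fin (m + 1) → ℂ), x ∈ Summit.Schanuel.Schanuel.Cruxes.MinimalCounterexampleInAcl.KernelArithmeticSelection.firstFailures (m + 1) → (∀ i : Fin (m + 1), (i : ℕ) < m → IsAlgebraic ℚ (Complex.exp (x i))) → (∀ M : Fin (m + 1) → ℤ, M (Fin.last m) ≠ 0 → Transcendental ℚ (Complex.exp (∑ i, (M i : ℂ) * x i))) → ∀ [inst : FirstOrder.Ring.CompatibleRing ℤ], (∅ : Set ℤ).Definable FirstOrder.Language.ring {κ : Fin m → ℤ | (fun k => x (Fin.castSucc k) + 2 * ↑Real.pi * Complex.I * (κ k : ℂ)) ∈ {v : Fin m → ℂ | ∃ x' ∈ Summit.Schanuel.Schanuel.Cruxes.MinimalCounterexampleInAcl.KernelArithmeticSelection.locusMates x, ∀ k, v k = x' (Fin.castSucc k)}} :=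 by
  intro m _hm x hx halg _hpure inst
  obtain ⟨S, hS₁, hS₂⟩ := exists_finset_generators_locusPts x
  -- the presentation functions
  set Y : (Fin m → ℤ) → ℂ → Fin (m + 1) → ℂ :=
    fun κ z => Fin.snoc (fun k => x (Fin.castSucc k) + 2 * ↑Real.pi * Complex.I * (κ k : ℂ)) z with hY
  set F : (Fin m → ℤ) → ℂ → ℝ :=
    fun κ z => ∑ p ∈ S, Complex.normSq (MvPolynomial.aeval (Sum.elim (Y κ z) (Complex.exp ∘ Y κ z)) p) with hF
  set G : (Fin m → ℤ) → (Fin (m + 1) → ℤ) → ℂ → ℝ :=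
    fun κ N z => F κ z + Complex.normSq (∑ i, (N i : ℂ) * Y κ z i) with hG
  -- zero sets
  have hFiff : ∀ κ z, F κ z = 0 ↔ Y κ z ∈ locusPts x := by
    intro κ z
    rw [hF]
    simp only
    rw [Finset.sum_eq_zero_iff_of_nonneg (fun p _ => Complex.normSq_nonneg _)]
    simp only [Complex.normSq_eq_zero]
    constructor
    · intro h; exact hS₂ _ h
    · intro h p hp; exact h p (hS₁ p hp)
  have hF0 : ∀ κ z, 0 ≤ F κ z := fun κ z => Finset.sum_nonneg fun p _ => Complex.normSq_nonneg _
  have hGiff : ∀ κ N z, G κ N z = 0 ↔ Y κ z ∈ locusPts x ∧ ∑ i, (N i : ℂ) * Y κ z i = 0 := by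
    intro κ N z
    rw [hG]
    simp only
    rw [add_eq_zero_iff_of_nonneg (hF0 κ z) (Complex.normSq_nonneg _), hFiff, Complex.normSq_eq_zero]
  have hG0 : ∀ κ N z, 0 ≤ G κ N z := fun κ N z => add_nonneg (hF0 κ z) (Complex.normSq_nonneg _)
  -- continuity
  have hFc : ∀ κ, Continuous (F κ) := fun κ => by
    rw [hF]
    refine continuous_finsetSum S fun p _ => Complex.continuous_normSq.comp ?_
    exact continuous_mvPolynomial_aeval p (continuous_mateCoord x κ)
  have hGc : ∀ κ N, Continuous (G κ N) := fun κ N => by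
    rw [hG]
    refine (hFc κ).add (Complex.continuous_normSq.comp (continuous_finsetSum _ fun i _ => ?_))
    exact continuous_const.mul (continuous_mateCoord x κ (Sum.inl i))
  -- definability of the values at Gaussian-rational test points
  have hFdef : (∅ : Set ℤ).Definable Language.ring {w : _ ⊕ Fin 2 → ℤ | 0 < w (Sum.inr 1) ∧ ((w (Sum.inr 0) : ℤ) : ℝ) < ((w (Sum.inr 1) : ℤ) : ℝ) * ((fun w : Fin m ⊕ Fin 3 → ℤ => F (fun k => w (Sum.inl k))
      ((((w (Sum.inr 0) : ℤ) : ℂ) + ((w (Sum.inr 1) : ℤ) : ℂ) * Complex.I) / ((w (Sum.inr 2) : ℤ) : ℂ))) ∘ fun w' s => w' (Sum.inl s)) w} :=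
    defR_sumNormSqAeval S (defC_mateCoord x halg)
  have hLdef : ((∅ : Set ℤ).Definable Language.ring {w : _ ⊕ Fin 2 → ℤ | 0 < w (Sum.inr 1) ∧ ((w (Sum.inr 0) : ℤ) : ℝ) < ((w (Sum.inr 1) : ℤ) : ℝ) * ((Complex.re ∘ (fun w : (Fin m ⊕ Fin (m + 1)) ⊕ Fin 3 → ℤ => ∑ i, ((w (Sum.inl (Sum.inr i)) : ℤ) : ℂ) *
      Y (fun k => w (Sum.inl (Sum.inl k)))
        ((((w (Sum.inr 0) : ℤ) : ℂ) + ((w (Sum.inr 1) : ℤ) : ℂ) * Complex.I) / ((w (Sum.inr 2) : ℤ) : ℂ)) i)) ∘ fun w' s => w' (Sum.inl s)) w} ∧ (∅ : Set ℤ).Definable Language.ring {w : _ ⊕ Fin 2 → ℤ | 0 < w (Sum.inr 1) ∧ ((w (Sum.inr 0) : ℤ) : ℝ) < ((w (Sum.inr 1) : ℤ) : ℝ) * ((Complex.im ∘ (fun w : (Fin m ⊕ Fin (m + 1)) ⊕ Fin 3 → ℤ => ∑ i, ((w (Sum.inl (Sum.inr i)) : ℤ) : ℂ) *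
      Y (fun k => w (Sum.inl (Sum.inl k)))
        ((((w (Sum.inr 0) : ℤ) : ℂ) + ((w (Sum.inr 1) : ℤ) : ℂ) * Complex.I) / ((w (Sum.inr 2) : ℤ) : ℂ)) i)) ∘ fun w' s => w' (Sum.inl s)) w}) :=
    defC_sum Finset.univ fun i _ => defC_mul (defC_intCast (definableFun_proj_params _))
      (defC_reindex (defC_mateCoord x halg (Sum.inl i)) (Sum.map Sum.inl id))
  have hGdef : (∅ : Set ℤ).Definable Language.ring {w : _ ⊕ Fin 2 → ℤ | 0 < w (Sum.inr 1) ∧ ((w (Sum.inr 0) : ℤ) : ℝ) < ((w (Sum.inr 1) : ℤ) : ℝ) * ((fun w : (Fin m ⊕ Fin (m + 1)) ⊕ Fin 3 → ℤ => G (fun k => w (Sum.inl (Sum.inl k)))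
      (fun i => w (Sum.inl (Sum.inr i)))
      ((((w (Sum.inr 0) : ℤ) : ℂ) + ((w (Sum.inr 1) : ℤ) : ℂ) * Complex.I) / ((w (Sum.inr 2) : ℤ) : ℂ))) ∘ fun w' s => w' (Sum.inl s)) w} :=
    defR_add (defR_reindex hFdef (Sum.map Sum.inl id)) (defR_normSq hLdef)
  -- "∃ zero in a box" as definable conditions on `(κ, b)` and on `(κ, b, N)`
  have hA := ringDefinable_setOf_existsZeroInBox (σ := Fin m ⊕ Fin 5) (fun v z => F (fun k => v (Sum.inl k)) z)
    (fun v => hFc _) (fun v z => hF0 _ z) (defR_reindex hFdef (Sum.map Sum.inl id))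
    (definableFun_proj_params (Sum.inr 0)) (definableFun_proj_params (Sum.inr 1))
    (definableFun_proj_params (Sum.inr 2)) (definableFun_proj_params (Sum.inr 3)) (definableFun_proj_params (Sum.inr 4))
  have hB := ringDefinable_setOf_existsZeroInBox (σ := (Fin m ⊕ Fin 5) ⊕ Fin (m + 1))
    (fun v z => G (fun k => v (Sum.inl (Sum.inl k))) (fun i => v (Sum.inr i)) z)
    (fun v => hGc _ _) (fun v z => hG0 _ _ z)
    (defR_reindex hGdef (Sum.map (Sum.map Sum.inl id) id))
    (definableFun_proj_params (Sum.inl (Sum.inr 0))) (definableFun_proj_params (Sum.inl (Sum.inr 1)))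
    (definableFun_proj_params (Sum.inl (Sum.inr 2))) (definableFun_proj_params (Sum.inl (Sum.inr 3)))
    (definableFun_proj_params (Sum.inl (Sum.inr 4)))
  -- the first-order definition of the hit pattern
  have hdef : (∅ : Set ℤ).Definable Language.ring {κ : Fin m → ℤ | ∃ b : Fin 5 → ℤ,
      (Sum.elim κ b) ∈ {v : Fin m ⊕ Fin 5 → ℤ | 0 < v (Sum.inr 4) ∧ ∃ z : ℂ,
        ((((v (Sum.inr 0)) : ℤ) : ℝ) / (((v (Sum.inr 4)) : ℤ) : ℝ) ≤ z.re ∧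
          z.re ≤ (((v (Sum.inr 1)) : ℤ) : ℝ) / (((v (Sum.inr 4)) : ℤ) : ℝ) ∧
          (((v (Sum.inr 2)) : ℤ) : ℝ) / (((v (Sum.inr 4)) : ℤ) : ℝ) ≤ z.im ∧
          z.im ≤ (((v (Sum.inr 3)) : ℤ) : ℝ) / (((v (Sum.inr 4)) : ℤ) : ℝ)) ∧
        (fun (v : Fin m ⊕ Fin 5 → ℤ) (z : ℂ) => F (fun k => v (Sum.inl k)) z) v z = 0} ∧
      ∀ N : Fin (m + 1) → ℤ, (¬ ∀ i, N i = 0) →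
        ¬ (Sum.elim (Sum.elim κ b) N) ∈ {v : (Fin m ⊕ Fin 5) ⊕ Fin (m + 1) → ℤ | 0 < v (Sum.inl (Sum.inr 4)) ∧ ∃ z : ℂ,
          ((((v (Sum.inl (Sum.inr 0))) : ℤ) : ℝ) / (((v (Sum.inl (Sum.inr 4))) : ℤ) : ℝ) ≤ z.re ∧
            z.re ≤ (((v (Sum.inl (Sum.inr 1))) : ℤ) : ℝ) / (((v (Sum.inl (Sum.inr 4))) : ℤ) : ℝ) ∧
            (((v (Sum.inl (Sum.inr 2))) : ℤ) : ℝ) / (((v (Sum.inl (Sum.inr 4))) : ℤ) : ℝ) ≤ z.im ∧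
            z.im ≤ (((v (Sum.inl (Sum.inr 3))) : ℤ) : ℝ) / (((v (Sum.inl (Sum.inr 4))) : ℤ) : ℝ)) ∧
          (fun (v : (Fin m ⊕ Fin 5) ⊕ Fin (m + 1) → ℤ) (z : ℂ) =>
            G (fun k => v (Sum.inl (Sum.inl k))) (fun i => v (Sum.inr i)) z) v z = 0}} := by
    refine definable_setOf_existsBlock (definable_setOf_and_params ?_ (definable_setOf_forallBlock
      (definable_setOf_imp_params (definable_setOf_not_params (definable_setOf_forallFin fun i =>
        definable_setOf_eq_params (definableFun_proj_params _) ringDefinableFun_zero))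
      (definable_setOf_not_params ?_))))
    · rw [setOf_sumElim_mem]; exact hA
    · rw [setOf_sumElim₂_mem]; exact hB
  -- the presentation theorem identifies the two sets
  convert hdef using 1
  ext κ
  have hb := mem_hitSet_iff_box m x hx halg κ (F κ) (G κ) (hFiff κ) (hGiff κ)
  simp only [mem_setOf_eq] at hb ⊢
  rw [hb]
  simp only [Sum.elim_inl, Sum.elim_inr]
  constructor
  · rintro ⟨b, hb4, hz, hN⟩
    refine ⟨b, ⟨hb4, hz⟩, fun N hN0 h => hN N (fun h0 => hN0 fun i => by rw [h0]; rfl) h.2⟩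
  · rintro ⟨b, ⟨hb4, hz⟩, hN⟩
    refine ⟨b, hb4, hz, fun N hN0 h => hN N (fun h0 => hN0 (funext h0)) ⟨hb4, h⟩⟩

end Summit.Schanuel.Schanuel.Cruxes.MinimalCounterexampleInAcl.KernelArithmeticSelection
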